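import Summits.HodgeConjecture.HodgeConjecture.Theses.SaitoKurokawaBridge

/-!
# Route `SaitoKurokawaBridge`: the glue `SaitoKurokawaBridgeGlue` (item `stmt-HodgeConjecture-14460`)

Pure logic. The support item `SaitoKurokawaBridgeGlue` of route `HodgeConjecture/SaitoKurokawaBridge`
states

  `SaitoKurokawaHodgeClass → NoAlgebraicSaitoKurokawaBridge → ExtremeBridgeFailure`.

Proof: destructure the witness `(M, N, κ, a, b)` of `SaitoKurokawaHodgeClass` with its
rationality / Hodge-type / invariance / non-vanishing hypotheses, and instantiate the Target
`ExtremeBridgeFailure` at `n := 17`, `Y := M.Z`, `X := N.Z` (smooth projective of dimension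
`3·1 + 17 − 3 = 3·2 + 14 − 3 = 17` by the structure fields `M.isSmoothProjective`,
`N.isSmoothProjective`); the degrees `2·17 = 17 + 17 = 34`, `34 + 17 = 51`, `51 + 17 = 68` are closed
numerals, so every conjunct matches definitionally. The last clause of the Target is
`NoAlgebraicSaitoKurokawaBridge M N a b` applied to the invariance and Hodge-type hypotheses.

No named facts are used; the theorem is unconditional (it is an implication between route decls).
-/

-- `Summit.HodgeConjecture.HodgeConjecture.Theorems` is the mandated namespace (single-conjunct summit:
-- Sub = Summit), which `linter.dupNamespace` flags on every declaration; the lakefile turns the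
-- linter off tree-wide (weak option), restated here so stand-alone elaboration is warning-free too.
set_option linter.dupNamespace false

namespace Summit.HodgeConjecture.HodgeConjecture.Theorems

/-- **Glue of route `SaitoKurokawaBridge`** (item `stmt-HodgeConjecture-14460`): the crux
`SaitoKurokawaHodgeClass` (a rational `(17,17)` Hodge class `κ` on `M.Z ⊗ N.Z` pairing non-trivially
with `fst*a ∪ snd*b` for invariant classes `a` of type `(17,0)` and `b` of type `(0,17)`) together with
the crux `NoAlgebraicSaitoKurokawaBridge` (every algebraic class pairs to zero with every such
`fst*a ∪ snd*b`) yields the Target `ExtremeBridgeFailure` at `n = 17`, `Y = M.Z`, `X = N.Z`.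
Pure logic over the route file's definitions. -/
theorem saitoKurokawaBridgeGlue_proof :
    Summit.HodgeConjecture.HodgeConjecture.Theses.SaitoKurokawaBridge.SaitoKurokawaBridgeGlue := by
  unfold Summit.HodgeConjecture.HodgeConjecture.Theses.SaitoKurokawaBridge.SaitoKurokawaBridgeGlue
  intro hSK hNo
  obtain ⟨M, N, κ, a, b, hrat, hκ, haInv, ha, hbInv, hb, hne⟩ := hSK
  exact ⟨17, M.Z, N.Z, M.isSmoothProjective, N.isSmoothProjective, κ, a, b, hrat, hκ, ha, hb, hne,
    hNo M N a b haInv ha hbInv hb⟩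

end Summit.HodgeConjecture.HodgeConjecture.Theorems
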